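import Literature.Computation.Certificates.PosSemidef
import Literature.Computation.Certificates.SumOfSquares

/-!
# SOS certificates in Gram form with a rounded PSD sub-certificate (`decide +kernel`)

Compute-infrastructure file (unit `infra-psd-sos-lp-checker`), joining `PosSemidef.lean` and
`SumOfSquares.lean`. A sum-of-squares multiplier is given here NOT as explicit weighted squares
but in GRAM FORM: a monomial basis `mb : Fin s → Monomial`, a rational Gram matrix
`Q : Matrix (Fin s) (Fin s) ℚ` with `σ(x) = m(x)ᵀ Q m(x)`, and a rounded PSD certificate `(d, B)`
of `Q` in the sense of `PSD.IsGramCertDD` (`d ≥ 0`, `Q − Bᵀ·diag d·B` symmetric diagonally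
dominant; an exact `Q = Bᵀ·diag d·B` is the special case of zero residual). This is the format a
numerical SDP solver delivers after the Peyrl–Parrilo rounding/projection step (`Q` exact on the
affine subspace `p = mᵀQm`, small denominators) WITHOUT the digit blow-up of an exact `LDLᵀ`
(Blekherman–Parrilo–Thomas 2012, Thm 3.39 and §3.1.6; Peyrl–Parrilo 2008).

## API (namespace `Literature.Computation.Certificates.SOS`)

* `GramSOS` (fields `s m mb Q d B`), `GramSOS.poly` (the term list of `mᵀQm`, normalised),
  `GramSOS.Valid` (`PSD.IsGramCertDD Q d B`, a decidable `Prop`), `GramSOS.ok` (its Boolean),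
  `GramSOS.eval_poly` (`= ∑ a, ∑ b, m_a(x) m_b(x) Q a b`), `GramSOS.eval_poly_nonneg`.
* `Poly.ineqPartG`, `Poly.CertG` (free Gram-SOS, one Gram-SOS per inequality hypothesis, one
  polynomial per equality hypothesis), `Poly.residualG`, the one-shot checker `Poly.checkG` with
  `Poly.nonneg_of_checkG` (same statement shape as `Poly.nonneg_of_check`), and the DECOMPOSED
  form `Poly.nonneg_of_validG` (PSD facts and residual zero-test as separate hypotheses, each its
  own — possibly block-split, `Certificates/Blocks.lean` — `decide +kernel`; use it beyond basis
  size ≈ 30, where one monolithic `decide` exceeds the kernel memory cap).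
* Kernel-checked `example`s at the end.

## References

[cite: BlekhermanParriloThomas2012, Thm 3.39]; [cite: PeyrlParrilo2008, §3].

## Not here

No basis selection (Newton polytope), no facial reduction: `mb` and `Q` come from the off-line
tool; the checker only verifies.
-/

namespace Literature.Computation.Certificates

namespace SOS

open Poly

/-- A **Gram-form SOS polynomial** `m(x)ᵀ Q m(x)` together with a rounded PSD certificate of its
Gram matrix: basis size `s`, factor rows `m`, monomial basis `mb`, Gram matrix `Q`, weights `d`
and factor `B` (checked by `PSD.IsGramCertDD Q d B`). [cite: BlekhermanParriloThomas2012, Thm 3.39] -/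
structure GramSOS where
  /-- Size of the monomial basis. -/
  s : ℕ
  /-- Number of rows of the factor `B`. -/
  m : ℕ
  /-- The monomial basis. -/
  mb : Fin s → Monomial
  /-- The Gram matrix. -/
  Q : Matrix (Fin s) (Fin s) ℚ
  /-- Weights of the (rounded) `LDLᵀ`-type factorisation of `Q`. -/
  d : Fin m → ℚ
  /-- Factor of the (rounded) factorisation of `Q`. -/
  B : Matrix (Fin m) (Fin s) ℚ

namespace GramSOS

/-- The polynomial `m(x)ᵀ Q m(x) = Σ_{a,b} Q_{ab} m_a m_b` as a normalised term list. [folklore] -/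
def poly (g : GramSOS) : Poly :=
  Poly.norm ((List.finRange g.s).flatMap fun a =>
    (List.finRange g.s).map fun b => (Monomial.mul (g.mb a) (g.mb b), g.Q a b))

/-- Validity of the PSD sub-certificate (rounded form `PSD.IsGramCertDD`; an exact `Q = BᵀDB` is
the zero-residual case, `PSD.IsGramCert.isGramCertDD`). A `Prop`, so that it can be proved
block-wise (`Certificates/Blocks.lean`) when one `decide` is too big. [folklore] -/
def Valid (g : GramSOS) : Prop :=
  PSD.IsGramCertDD g.Q g.d g.B

/-- Decidability of `Valid`. [folklore] -/
instance Valid.instDecidable (g : GramSOS) : Decidable g.Valid :=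
  inferInstanceAs (Decidable (PSD.IsGramCertDD g.Q g.d g.B))

/-- The PSD check of the Gram matrix as a Boolean (one-shot use inside `Poly.checkG`). [folklore] -/
def ok (g : GramSOS) : Bool :=
  decide g.Valid

/-- `ok = true` means `Valid`. [folklore] -/
theorem valid_of_ok {g : GramSOS} (h : g.ok = true) : g.Valid :=
  of_decide_eq_true h

section EvalField

variable {R : Type*} [Field R]

/-- `eval` over a `flatMap` is the sum of the `eval`s. [folklore] -/
theorem _root_.Literature.Computation.Certificates.SOS.Poly.eval_flatMap {α : Type*} (x : ℕ → R)
    (f : α → Poly) : ∀ l : List α, Poly.eval x (l.flatMap f) = (l.map fun a => Poly.eval x (f a)).sum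
  | [] => by simp
  | a :: l => by
      rw [List.flatMap_cons, Poly.eval_append, Poly.eval_flatMap x f l, List.map_cons, List.sum_cons]

/-- `eval` of a list of single terms. [folklore] -/
theorem _root_.Literature.Computation.Certificates.SOS.Poly.eval_map_term {α : Type*} (x : ℕ → R)
    (mo : α → Monomial) (c : α → ℚ) :
    ∀ l : List α, Poly.eval x (l.map fun a => (mo a, c a)) =
      (l.map fun a => (c a : R) * (mo a).eval x).sum
  | [] => by simp
  | a :: l => by
      rw [List.map_cons, Poly.eval_cons, Poly.eval_map_term x mo c l, List.map_cons, List.sum_cons]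

end EvalField

section Eval

variable {R : Type*} [Field R] [CharZero R]

/-- **Semantics of the Gram polynomial**: `g.poly` evaluates to the quadratic form of `Q` at the
vector of basis-monomial values. [cite: BlekhermanParriloThomas2012, Thm 3.39] -/
theorem eval_poly (g : GramSOS) (x : ℕ → R) :
    g.poly.eval x = ∑ a, ∑ b, (g.mb a).eval x * (g.mb b).eval x * (g.Q a b : R) := by
  rw [poly, Poly.eval_norm, Poly.eval_flatMap]
  simp_rw [Poly.eval_map_term, Monomial.eval_mul, ← Fin.sum_univ_def]
  exact Finset.sum_congr rfl fun a _ => Finset.sum_congr rfl fun b _ => by ring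

end Eval

section Ordered

variable {R : Type*} [Field R] [LinearOrder R] [IsStrictOrderedRing R]

/-- **A Gram-form SOS with a valid PSD sub-certificate is nonnegative everywhere.**
[cite: BlekhermanParriloThomas2012, Thm 3.39] -/
theorem eval_poly_nonneg (g : GramSOS) (h : g.Valid) (x : ℕ → R) : 0 ≤ g.poly.eval x := by
  rw [eval_poly]
  exact (h : PSD.IsGramCertDD g.Q g.d g.B).quadForm_nonneg' fun a => (g.mb a).eval x

end Ordered

end GramSOS

namespace Poly

section CharZero

variable {R : Type*} [Field R] [CharZero R]

/-- The inequality part `Σ_i g_i · σ_i` with Gram-form SOS multipliers (by position).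
[cite: BlekhermanParriloThomas2012, Thm 3.127] -/
def ineqPartG : List Poly → List GramSOS → Poly
  | g :: gs, σ :: σs => add (mul (norm g) σ.poly) (ineqPartG gs σs)
  | _, _ => []

/-- A **Gram-form Positivstellensatz certificate** for `p ≥ 0` under `gs ≥ 0`, `hs = 0`.
[cite: BlekhermanParriloThomas2012, Thm 3.127] -/
structure CertG where
  /-- The free SOS part, in Gram form. -/
  free : GramSOS
  /-- One Gram-form SOS multiplier per inequality hypothesis (by position). -/
  ineqMult : List GramSOS
  /-- One polynomial multiplier per equality hypothesis (by position). -/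
  eqMult : List Poly

/-- Residual `p − (σ₀ + Σ gᵢ σᵢ + Σ hⱼ tⱼ)` of a Gram-form certificate. [folklore] -/
def residualG (p : Poly) (gs hs : List Poly) (cert : CertG) : Poly :=
  add (norm p) (neg (add cert.free.poly (add (ineqPartG gs cert.ineqMult) (eqPart hs cert.eqMult))))

/-- **The Gram-form checker**: every Gram matrix passes its rounded PSD check and the residual is
the zero polynomial. Computable; `decide +kernel` on numeral data.
[cite: BlekhermanParriloThomas2012, Thm 3.127] -/
def checkG (p : Poly) (gs hs : List Poly) (cert : CertG) : Bool :=
  cert.free.ok && cert.ineqMult.all GramSOS.ok && isZero (residualG p gs hs cert)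

end CharZero

section Ordered

variable {R : Type*} [Field R] [LinearOrder R] [IsStrictOrderedRing R]

/-- The Gram-form inequality part is nonnegative wherever the hypotheses hold.
[cite: BlekhermanParriloThomas2012, Thm 3.127] -/
theorem eval_ineqPartG_nonneg (x : ℕ → R) :
    ∀ (gs : List Poly) (σs : List GramSOS), (∀ g ∈ gs, 0 ≤ eval x g) →
      (∀ σ ∈ σs, σ.Valid) → 0 ≤ eval x (ineqPartG gs σs)
  | g :: gs, σ :: σs, hg, hσ => by
      rw [ineqPartG, eval_add, eval_mul, eval_norm]
      exact add_nonneg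
        (mul_nonneg (hg g List.mem_cons_self) (σ.eval_poly_nonneg (hσ σ List.mem_cons_self) x))
        (eval_ineqPartG_nonneg x gs σs (fun g' hg' => hg g' (List.mem_cons_of_mem _ hg'))
          (fun σ' hσ' => hσ σ' (List.mem_cons_of_mem _ hσ')))
  | [], _, _, _ => by simp [ineqPartG]
  | _ :: _, [], _, _ => by simp [ineqPartG]

/-- **Soundness, decomposed form** (for large certificates): the PSD sub-certificates as `Prop`
hypotheses — each provable by its own, possibly block-split, `decide +kernel` — plus the zero
test of the residual give `p(x) ≥ 0` under the hypotheses.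
[cite: BlekhermanParriloThomas2012, Thm 3.127] -/
theorem nonneg_of_validG {p : Poly} {gs hs : List Poly} {cert : CertG} (hf : cert.free.Valid)
    (hσ : ∀ σ ∈ cert.ineqMult, σ.Valid) (hz : isZero (residualG p gs hs cert) = true)
    (x : ℕ → R) (hg : ∀ g ∈ gs, 0 ≤ eval x g) (hh : ∀ h ∈ hs, eval x h = 0) : 0 ≤ eval x p := by
  have h0 := eval_eq_zero_of_isZero x hz
  rw [residualG, eval_add, eval_norm, eval_neg, eval_add, eval_add] at h0
  have h1 := cert.free.eval_poly_nonneg hf x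
  have h2 := eval_ineqPartG_nonneg x gs cert.ineqMult hg hσ
  have h3 := eval_eqPart x hs cert.eqMult hh
  linarith

/-- **Soundness of Gram-form SOS / Positivstellensatz certificates** (one-shot form): if `checkG`
accepts, then `p(x) ≥ 0` wherever all `g ∈ gs` are `≥ 0` and all `h ∈ hs` vanish (any linearly
ordered field). [cite: BlekhermanParriloThomas2012, Thm 3.127] -/
theorem nonneg_of_checkG {p : Poly} {gs hs : List Poly} {cert : CertG}
    (hc : checkG p gs hs cert = true) (x : ℕ → R) (hg : ∀ g ∈ gs, 0 ≤ eval x g)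
    (hh : ∀ h ∈ hs, eval x h = 0) : 0 ≤ eval x p := by
  simp only [checkG, Bool.and_eq_true, List.all_eq_true] at hc
  obtain ⟨⟨hf, hσ⟩, hz⟩ := hc
  exact nonneg_of_validG (GramSOS.valid_of_ok hf) (fun σ h => GramSOS.valid_of_ok (hσ σ h)) hz x
    hg hh

/-- Unconstrained special case. [cite: BlekhermanParriloThomas2012, Thm 3.39] -/
theorem nonneg_of_checkG_nil {p : Poly} {cert : CertG} (hc : checkG p [] [] cert = true)
    (x : ℕ → R) : 0 ≤ eval x p :=
  nonneg_of_checkG hc x (by simp) (by simp)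

end Ordered

end Poly

/-! ### Tests / usage templates (kernel-checked) -/

section TestsG

open Poly

/-- Test (Gram form, exact sub-certificate): `2a² − 2ab + 2b² = (a b) Q (a b)ᵀ` with
`Q = [[2, -1], [-1, 2]]`, basis `(a, b)`, `Q = BᵀDB` exactly (`d = (2, 3/2)`). -/
example (a b : ℝ) : 0 ≤ 2 * a ^ 2 - 2 * a * b + 2 * b ^ 2 := by
  have h := nonneg_of_checkG_nil
    (p := [(([2] : List ℕ), (2 : ℚ)), (([1, 1] : List ℕ), (-2 : ℚ)), (([0, 2] : List ℕ), (2 : ℚ))])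
    (cert := ⟨⟨2, 2, ![([1] : List ℕ), ([0, 1] : List ℕ)], !![2, -1; -1, 2], ![2, 3 / 2],
      !![1, -1 / 2; 0, 1]⟩, [], []⟩)
    (by decide +kernel) (vars [a, b])
  simp only [eval_cons, eval_nil, Monomial.eval_eq, Monomial.evalFrom_cons, Monomial.evalFrom_nil,
    vars_cons_zero, vars_cons_succ] at h
  push_cast at h
  linarith

/-- Test (Gram form, ROUNDED sub-certificate and an inequality multiplier): for `t ≥ 0`,
`t³ − t² + t ≥ 0` since `t³ − t² + t = t · (1 t) Q (1 t)ᵀ` with `Q = [[1, -1/2], [-1/2, 1]]`,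
certified by the one-digit factor `B = [[1, -1/2], [0, 1]]`, `d = (1, 7/10)` whose residual
`diag(0, 1/20)` is diagonally dominant. Free part: the empty Gram form (`s = 0`). -/
example (t : ℝ) (ht : 0 ≤ t) : t ^ 2 ≤ t ^ 3 + t := by
  have h := nonneg_of_checkG
    (p := [(([3] : List ℕ), (1 : ℚ)), (([2] : List ℕ), (-1 : ℚ)), (([1] : List ℕ), (1 : ℚ))])
    (gs := [X 0]) (hs := [])
    (cert := ⟨⟨0, 0, ![], Matrix.of ![], ![], Matrix.of ![]⟩,
      [⟨2, 2, ![([] : List ℕ), ([1] : List ℕ)], !![1, -1 / 2; -1 / 2, 1], ![1, 7 / 10],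
        !![1, -1 / 2; 0, 1]⟩], []⟩)
    (by decide +kernel) (vars [t]) (by simpa using ht) (by simp)
  simp only [eval_cons, eval_nil, Monomial.eval_eq, Monomial.evalFrom_cons, Monomial.evalFrom_nil,
    vars_cons_zero] at h
  push_cast at h
  linarith

/-- Test (decomposed form `nonneg_of_validG`, the pattern for big certificates): the same
`t³ − t² + t ≥ 0` for `t ≥ 0`, with the PSD facts and the residual test as three separate
`decide +kernel` calls. -/
example (t : ℝ) (ht : 0 ≤ t) : t ^ 2 ≤ t ^ 3 + t := by
  have h := nonneg_of_validG
    (p := [(([3] : List ℕ), (1 : ℚ)), (([2] : List ℕ), (-1 : ℚ)), (([1] : List ℕ), (1 : ℚ))])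
    (gs := [X 0]) (hs := [])
    (cert := ⟨⟨0, 0, ![], Matrix.of ![], ![], Matrix.of ![]⟩,
      [⟨2, 2, ![([] : List ℕ), ([1] : List ℕ)], !![1, -1 / 2; -1 / 2, 1], ![1, 7 / 10],
        !![1, -1 / 2; 0, 1]⟩], []⟩)
    (by decide +kernel)
    (by intro σ hσ; simp only [List.mem_singleton] at hσ; subst hσ; decide +kernel)
    (by decide +kernel) (vars [t]) (by simpa using ht) (by simp)
  simp only [eval_cons, eval_nil, Monomial.eval_eq, Monomial.evalFrom_cons, Monomial.evalFrom_nil,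
    vars_cons_zero] at h
  push_cast at h
  linarith

end TestsG

end SOS

end Literature.Computation.Certificates
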